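import Literature.Geometry.Riemannian.GeodesicBallsMetric
import Literature.Geometry.Riemannian.ExpMapGaussLemma
import Literature.Geometry.Riemannian.ExponentialMapDifferential
import Literature.Geometry.Riemannian.ExponentialMapSmooth
import Literature.Geometry.Riemannian.ExpMapGlobalSmooth
import Literature.Geometry.Riemannian.HopfRinowCompact
import Mathlib.Analysis.Calculus.InverseFunctionTheorem.FDeriv
import Mathlib.Analysis.Calculus.InverseFunctionTheorem.ContDiff
import HarnessLib

/-!
# Uniformly normal neighbourhoods and the uniform normal radius of a compact manifold
(Lee 2018, Lemma 6.16 with Prop. 6.11, Cor. 6.12–6.13)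

For a smooth Riemannian metric `g` (a Riemannian `PseudoRiemannianMetric` of class `C^n`,
`∞ ≤ n`) with complete Levi-Civita connection on a Hausdorff manifold over a boundaryless model:

* `exists_uniformly_normal_nhds` — **Lee's Lemma 6.16 ("every point has a uniformly normal
  neighbourhood"), quantitative**: every `p` has a neighbourhood `U` and a radius `ε > 0` such that
  for EVERY `q ∈ U` (1) the radial geodesics from `q` of length `< ε` minimise,
  `d(q, exp_q v) = |v|_g` for `|v|_g < ε` (Prop. 6.11 / Cor. 6.12), (2) the metric ball
  `{d(q, ·) < ε}` is the geodesic ball `exp_q {|v|_g < ε}` (Cor. 6.13), and (3) `exp_q` is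
  injective on `{|v|_g < ε}`.
  Proof (Lee, proof of Lemma 6.16 / Prop. 5.19 (e)): in the extended chart `φ` at `p` and the
  extended chart `Φ` of `TM` at `0_p`, the map `F̂(x, ξ) = (x, φ(exp(Φ⁻¹(x, ξ))))` is smooth near
  `(φ p, 0)` with invertible derivative `(a, b) ↦ (a, A a + b)` (because `d(φ ∘ exp_p)_0 = id`,
  `exists_ball_contDiffOn_extChartAt_expMap`), so the inverse function theorem
  (`HasStrictFDerivAt.toOpenPartialHomeomorph`, `OpenPartialHomeomorph.contDiffAt_symm`) inverts it
  near `(φ p, φ p)` with a `C¹` inverse; for `q` near `p` this inverse is a `C¹` inverse `Log_q` of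
  `exp_q` on a FIXED neighbourhood of `p`, inverting the `g_q`-ball of a radius independent of `q`
  (uniform coercivity of `g` in the trivialisation, `exists_nhds_mul_norm_sq_le_val`); the metric
  statements (1), (2) are then Lee's Prop. 6.11 / Cor. 6.12–6.13 in the abstract form proved in
  `GeodesicBallsMetric.lean` (`edist_eq_of_mem_ball`, `exists_eq_of_edist_lt`, fed with the Gauss
  lemma `gaussLemma`).
* `exists_uniform_normalRadius` — **on a compact manifold one radius works for all points**
  (finite subcover): the positivity of the injectivity radius of a compact manifold in the form
  used by Birkhoff's curve-shortening / the Lusternik–Fet argument (any two points at distance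
  `< ε` are joined by a unique geodesic of length `< ε`, which is minimising).
* Chart bookkeeping for `TM` at a point of the zero section (`trivializationAt_symm_snd`,
  `trivializationAt_snd_symm`, `trivializationAt_symm_self`, `mem_extChartAt_tangent_source`,
  `extChartAt_tangent_zero_apply`, `extChartAt_tangent_zero_self`).

No definitions, no named facts (D-0026). Written for the proof of
`PaternainSaloUhlmann2023_contractible_sublevel` (Birkhoff curve shortening in a convex domain).

## References

* J. M. Lee, *Introduction to Riemannian Manifolds*, 2nd ed. (2018): Prop. 5.19, Thm. 6.9,
  Prop. 6.11, Cor. 6.12–6.13 (pp. 158–163), Lemma 6.16 (p. 163). [LeeRiemannianManifolds2018]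
-/

noncomputable section

open Bundle Set Filter Function Metric Manifold
open scoped Manifold ContDiff Topology ENNReal NNReal

namespace Literature.Geometry.Riemannian

open Literature.Geometry.Lorentzian
open Literature.Geometry.Lorentzian.PseudoRiemannianMetric

variable {E : Type*} [NormedAddCommGroup E] [NormedSpace ℝ E] {H : Type*} [TopologicalSpace H]
  {I : ModelWithCorners ℝ E H} {M : Type*} [TopologicalSpace M] [ChartedSpace H M]
  [IsManifold I ∞ M]

/-! ### The extended chart of `TM` at a point of the zero section -/

section TangentChart

/-- The inverse trivialisation recovers the vector: `e₁.symm q (e₁ ⟨q, w⟩).2 = w` over the base set.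
[folklore] -/
theorem trivializationAt_symm_snd {p q : M} (hq : q ∈ (chartAt H p).source) (w : TangentSpace I q) :
    (trivializationAt E (TangentSpace I) p).symm q (trivializationAt E (TangentSpace I) p ⟨q, w⟩).2 = w :=
  (trivializationAt E (TangentSpace I) p).symm_proj_apply ⟨q, w⟩
    (by rwa [TangentBundle.trivializationAt_baseSet])

/-- `(e₁ ⟨q, e₁.symm q ξ⟩).2 = ξ` over the base set. [folklore] -/
theorem trivializationAt_snd_symm {p q : M} (hq : q ∈ (chartAt H p).source) (ξ : E) :
    (trivializationAt E (TangentSpace I) p ⟨q, (trivializationAt E (TangentSpace I) p).symm q ξ⟩).2 = ξ := by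
  have h := (trivializationAt E (TangentSpace I) p).apply_mk_symm
    (show q ∈ (trivializationAt E (TangentSpace I) p).baseSet by
      rwa [TangentBundle.trivializationAt_baseSet]) ξ
  exact congrArg Prod.snd h

/-- Over its own base point the inverse trivialisation is the identity: `e₁.symm p ξ = ξ`. [folklore] -/
theorem trivializationAt_symm_self (p : M) (ξ : E) :
    (trivializationAt E (TangentSpace I) p).symm p ξ = ξ := by
  have h1 := trivializationAt_snd_symm (I := I) (mem_chart_source H p) ξ
  rwa [trivializationAt_snd_self] at h1

/-- A tangent vector over the chart domain of `p` lies in the source of the extended chart of `TM`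
at `0_p`. [folklore] -/
theorem mem_extChartAt_tangent_source {p q : M} (hq : q ∈ (chartAt H p).source)
    (w : TangentSpace I q) :
    (⟨q, w⟩ : TangentBundle I M) ∈ (extChartAt I.tangent (⟨p, (0 : TangentSpace I p)⟩ : TangentBundle I M)).source := by
  rw [extChartAt_source]
  exact (TangentBundle.mem_chart_source_iff _ _).2 hq


/-- The extended chart of `TM` at `0_p` sends `⟨q, w⟩` over the chart domain to
`(φ q, (e₁ ⟨q, w⟩).2)`, `φ = extChartAt I p`, `e₁` the trivialisation at `p`. [folklore] -/
theorem extChartAt_tangent_zero_apply (p q : M) (w : TangentSpace I q) :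
    extChartAt I.tangent (⟨p, (0 : TangentSpace I p)⟩ : TangentBundle I M) ⟨q, w⟩ =
      (extChartAt I p q, (trivializationAt E (TangentSpace I) p ⟨q, w⟩).2) :=
  extChartAt_tangent_apply _ _

/-- The extended chart of `TM` at `0_p` sends `0_p` to `(φ p, 0)`. [folklore] -/
theorem extChartAt_tangent_zero_self (p : M) :
    extChartAt I.tangent (⟨p, (0 : TangentSpace I p)⟩ : TangentBundle I M) ⟨p, 0⟩ =
      (extChartAt I p p, 0) := by
  rw [extChartAt_tangent_zero_apply, trivializationAt_snd_self]
  rfl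

end TangentChart

/-! ### Uniformly normal neighbourhoods -/

section Uniform

variable {n : ℕ∞ω} [FiniteDimensional ℝ E] [CompleteSpace E] [T2Space M] [I.Boundaryless]
  (g : PseudoRiemannianMetric I n E (TangentSpace I : M → Type _)) [g.HasLeviCivita]
  [CovariantDerivative.ContMDiffCovariantDerivative g.leviCivita 1]

omit [CompleteSpace E] [T2Space M] [I.Boundaryless] [g.HasLeviCivita]
  [CovariantDerivative.ContMDiffCovariantDerivative g.leviCivita 1] in
/-- **Uniform coercivity of `g` in a trivialisation**: near `p`, the chart norm of a tangent vector
is controlled by its `g`-length, `m ‖(e₁ v).2‖² ≤ g(v, v)` with one constant `m > 0` for all base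
points in a neighbourhood of `p` (compactness of a closed chart ball times the unit sphere and
positivity of `g`; cf. `PseudoRiemannianMetric.exists_isCompact_tangent_superset`). [folklore] -/
theorem exists_nhds_mul_norm_sq_le_val [LocallyCompactSpace M] (hg : g.IsRiemannian) (p : M) :
    ∃ N ∈ 𝓝 p, N ⊆ (chartAt H p).source ∧ ∃ m > (0 : ℝ), ∀ q ∈ N, ∀ w : TangentSpace I q,
      m * ‖(trivializationAt E (TangentSpace I) p ⟨q, w⟩).2‖ ^ 2 ≤ g.val q w w := by
  classical
  set e := trivializationAt E (TangentSpace I : M → Type _) p with he_def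
  have hpe : p ∈ e.baseSet := FiberBundle.mem_baseSet_trivializationAt' p
  obtain ⟨N, hN, hNe, hNc⟩ := local_compact_nhds (e.open_baseSet.mem_nhds hpe)
  have hF := g.continuous_val_tangentBundle
  set Φ : M × E → ℝ := fun yw ↦ g.val yw.1 (e.symm yw.1 yw.2) (e.symm yw.1 yw.2) with hΦ_def
  have hΦc : ContinuousOn Φ (e.baseSet ×ˢ univ) := hF.comp_continuousOn e.continuousOn_symm
  have hΦsmul : ∀ y ∈ e.baseSet, ∀ (c : ℝ) (w : E), Φ (y, c • w) = c ^ 2 * Φ (y, w) := by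
    intro y hy c w
    simp only [hΦ_def]
    rw [← e.symmL_apply (R := ℝ) hy, ← e.symmL_apply (R := ℝ) hy, map_smul]
    simp only [map_smul, smul_apply, smul_eq_mul]
    ring
  obtain ⟨m, hm, hmΦ⟩ : ∃ m : ℝ, 0 < m ∧ ∀ yw ∈ N ×ˢ sphere (0 : E) 1, m ≤ Φ yw := by
    by_cases hne : (N ×ˢ sphere (0 : E) 1).Nonempty
    · have hc : IsCompact (N ×ˢ sphere (0 : E) 1) := hNc.prod (isCompact_sphere 0 1)
      obtain ⟨yw₀, hyw₀, hmin⟩ :=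
        hc.exists_isMinOn hne (hΦc.mono (prod_mono hNe (subset_univ _)))
      refine ⟨Φ yw₀, ?_, fun yw hyw ↦ hmin hyw⟩
      have hy₀ : yw₀.1 ∈ e.baseSet := hNe hyw₀.1
      have hw₀ : e.symm yw₀.1 yw₀.2 ≠ 0 := by
        intro h0
        have h2 : e.symmL ℝ yw₀.1 yw₀.2 = 0 := by rwa [e.symmL_apply (R := ℝ) hy₀]
        have h3 := congrArg (e.continuousLinearMapAt ℝ yw₀.1) h2
        rw [e.continuousLinearMapAt_symmL hy₀, map_zero] at h3
        have h4 : ‖yw₀.2‖ = 1 := by simpa using hyw₀.2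
        rw [h3, norm_zero] at h4
        exact zero_ne_one h4
      exact hg _ _ hw₀
    · exact ⟨1, one_pos, fun yw hyw ↦ (hne ⟨yw, hyw⟩).elim⟩
  refine ⟨N, hN, by rwa [TangentBundle.trivializationAt_baseSet] at hNe, m, hm, fun q hq w ↦ ?_⟩
  have hqe : q ∈ e.baseSet := hNe hq
  set ξ : E := (e ⟨q, w⟩).2 with hξ_def
  have hsym : e.symm q ξ = w := e.symm_proj_apply ⟨q, w⟩ hqe
  by_cases hξ0 : ξ = 0
  · rw [hξ0, norm_zero, zero_pow two_ne_zero, mul_zero]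
    by_cases hw0 : w = 0
    · rw [hw0]; simp
    · exact (hg q w hw0).le
  · have hξpos : 0 < ‖ξ‖ := norm_pos_iff.2 hξ0
    set u : E := ‖ξ‖⁻¹ • ξ with hu_def
    have hu : u ∈ sphere (0 : E) 1 := by
      rw [mem_sphere_zero_iff_norm, hu_def, norm_smul, norm_inv, norm_norm,
        inv_mul_cancel₀ hξpos.ne']
    have h1 : m ≤ Φ (q, u) := hmΦ _ ⟨hq, hu⟩
    have h2 : Φ (q, u) = ‖ξ‖⁻¹ ^ 2 * Φ (q, ξ) := hΦsmul _ hqe _ _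
    have h3 : Φ (q, ξ) = g.val q w w := by simp only [hΦ_def, hsym]
    rw [h2, h3] at h1
    have h5 := mul_le_mul_of_nonneg_right h1 (sq_nonneg ‖ξ‖)
    calc m * ‖ξ‖ ^ 2 ≤ ‖ξ‖⁻¹ ^ 2 * g.val q w w * ‖ξ‖ ^ 2 := h5
      _ = g.val q w w := by field_simp
set_option maxHeartbeats 400000 in -- buildfix (bf3-g26): 160k/180k FAIL, 200k PASS at accept time; line-neutral budget line
/-- **Uniformly normal neighbourhoods with a uniform normal radius** (Lee 2018, Lemma 6.16
"every point has a uniformly normal neighbourhood", made quantitative with Prop. 6.11 and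
Cor. 6.12–6.13). Smooth Riemannian metric, complete Levi-Civita connection, Hausdorff manifold,
boundaryless model. For every `p` there are a neighbourhood `U` of `p` and `ε > 0` such that for
EVERY `q ∈ U`: (1) `d(q, exp_q v) = |v|_g` whenever `|v|_g < ε`; (2) every `x` with `d(q, x) < ε`
is `exp_q v` for some `|v|_g < ε`; (3) `exp_q` is injective on `{|v|_g < ε}`. Proof: in the chart
`φ` at `p` with the trivialisation `e₁` of `TM` at `p`, the map `F̂(x, ξ) = (x, φ(exp(Φ⁻¹(x, ξ))))`
(`Φ` the extended chart of `TM` at `0_p`) is smooth near `(φ p, 0)` with derivative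
`(a, b) ↦ (a, A a + b)` (since `d(φ ∘ exp_p)_0 = id`), an isomorphism; the inverse function theorem
inverts it near `(φ p, φ p)` with a `C¹` inverse, which for each `q` near `p` is a `C¹` inverse
`Log_q` of `exp_q` defined on a fixed neighbourhood of `p` and inverting a `g_q`-ball of radius
independent of `q` (uniform coercivity of `g` in the trivialisation,
`exists_nhds_mul_norm_sq_le_val`); then Lee's Prop. 6.11 / Cor. 6.12–6.13 in the abstract form
`edist_eq_of_mem_ball`, `exists_eq_of_edist_lt` (`GeodesicBallsMetric.lean`, Gauss lemma
`gaussLemma`) give (1) and (2), and the left inverse gives (3).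
[cite: LeeRiemannianManifolds2018, Lemma 6.16, Prop. 6.11 and Cor. 6.12–6.13] -/
theorem exists_uniformly_normal_nhds (hn : (∞ : ℕ∞ω) ≤ n) (hg : g.IsRiemannian)
    (hc : IsGeodesicallyComplete g.leviCivita) (p : M) :
    ∃ U ∈ 𝓝 p, ∃ ε > (0 : ℝ), ∀ q ∈ U,
      (∀ v : TangentSpace I q, g.val q v v < ε ^ 2 →
        g.edist hg q (expMap g.leviCivita q v) = ENNReal.ofReal (Real.sqrt (g.val q v v))) ∧
      (∀ x : M, g.edist hg q x < ENNReal.ofReal ε →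
        ∃ v : TangentSpace I q, g.val q v v < ε ^ 2 ∧ expMap g.leviCivita q v = x) ∧
      InjOn (fun v : TangentSpace I q ↦ expMap g.leviCivita q v) {v | g.val q v v < ε ^ 2} := by
  haveI : Fact (1 ≤ n) := ⟨le_trans (by exact_mod_cast le_top) hn⟩
  haveI := contMDiffCovariantDerivative_leviCivita_infty g hn
  haveI : LocallyCompactSpace M := Manifold.locallyCompact_of_finiteDimensional I
  set cov := g.leviCivita with hcov
  -- charts
  set φ := extChartAt I p with hφ
  set e := trivializationAt E (TangentSpace I : M → Type _) p with he
  set z₀ : TangentBundle I M := ⟨p, (0 : TangentSpace I p)⟩ with hz₀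
  set Φ := extChartAt I.tangent z₀ with hΦ
  set ex : TangentBundle I M → M := fun w ↦ expMap cov w.proj w.2 with hex
  have hexs : ContMDiff I.tangent I ∞ ex := by
    have h := contMDiffOn_expMap_totalSpace (cov := cov) (k := (⊤ : ℕ∞)) le_top
    have hu : {w : TangentBundle I M | (1 : ℝ) ∈ maximalGeodesicDomain cov w.proj w.2} = univ :=
      eq_univ_of_forall fun w ↦ by
        show (1 : ℝ) ∈ maximalGeodesicDomain cov w.proj w.2
        rw [(maximalGeodesic_of_isGeodesicallyComplete hc w.proj w.2).1]
        exact mem_univ _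
    rw [hu] at h
    exact contMDiffOn_univ.1 h
  have hex0 : ∀ q : M, ex ⟨q, (0 : TangentSpace I q)⟩ = q := fun q ↦ expMap_zero (cov := cov) q
  -- basic chart facts
  have hps : p ∈ (chartAt H p).source := mem_chart_source H p
  have hφsrc : φ.source = (chartAt H p).source := extChartAt_source I p
  have hsrcΦ : ∀ {q : M}, q ∈ (chartAt H p).source → ∀ w : TangentSpace I q,
      (⟨q, w⟩ : TangentBundle I M) ∈ Φ.source := fun hq w ↦ mem_extChartAt_tangent_source hq w
  have hΦapp : ∀ (q : M) (w : TangentSpace I q), Φ ⟨q, w⟩ = (φ q, (e ⟨q, w⟩).2) := fun q w ↦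
    extChartAt_tangent_zero_apply p q w
  have hΦz₀ : Φ z₀ = (φ p, 0) := extChartAt_tangent_zero_self p
  have hz₀src : z₀ ∈ Φ.source := hsrcΦ hps 0
  -- `Φ.symm (φ q, ξ) = ⟨q, e.symm q ξ⟩` over the chart domain
  have hΦsymm : ∀ {q : M}, q ∈ (chartAt H p).source → ∀ ξ : E,
      Φ.symm (φ q, ξ) = ⟨q, e.symm q ξ⟩ := by
    intro q hq ξ
    have h1 : Φ ⟨q, e.symm q ξ⟩ = (φ q, ξ) := by
      rw [hΦapp, trivializationAt_snd_symm hq]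
    rw [← h1]
    exact Φ.left_inv (hsrcΦ hq _)
  -- the smooth map `W (x, ξ) = φ (exp (Φ⁻¹ (x, ξ)))` and `F̂ (x, ξ) = (x, W (x, ξ))`
  set W : E × E → E := fun z ↦ φ (ex (Φ.symm z)) with hW
  set O : Set (E × E) := Φ.target ∩ (fun z ↦ ex (Φ.symm z)) ⁻¹' (chartAt H p).source with hO
  have hΦt : IsOpen Φ.target := isOpen_extChartAt_target z₀
  have hcont1 : ContinuousOn (fun z ↦ ex (Φ.symm z)) Φ.target :=
    hexs.continuous.comp_continuousOn (continuousOn_extChartAt_symm z₀)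
  have hOo : IsOpen O := hcont1.isOpen_inter_preimage hΦt (chartAt H p).open_source
  have hWs : ContDiffOn ℝ ∞ W O := by
    have h1 : ContMDiffOn 𝓘(ℝ, E × E) I.tangent ∞ Φ.symm Φ.target := contMDiffOn_extChartAt_symm z₀
    have h2 : ContMDiffOn 𝓘(ℝ, E × E) I ∞ (fun z ↦ ex (Φ.symm z)) Φ.target :=
      hexs.comp_contMDiffOn h1
    have h3 : ContMDiffOn I 𝓘(ℝ, E) ∞ φ (chartAt H p).source := contMDiffOn_extChartAt
    have h4 : ContMDiffOn 𝓘(ℝ, E × E) 𝓘(ℝ, E) ∞ W O :=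
      h3.comp (h2.mono inter_subset_left) fun z hz ↦ hz.2
    exact contMDiffOn_iff_contDiffOn.1 h4
  have hz₀O : (φ p, (0 : E)) ∈ O := by
    refine ⟨?_, ?_⟩
    · rw [← hΦz₀]; exact Φ.map_source hz₀src
    · show ex (Φ.symm (φ p, 0)) ∈ (chartAt H p).source
      rw [hΦsymm hps, trivializationAt_symm_self]
      convert hps using 1
      exact hex0 p
  have hWat : ContDiffAt ℝ ∞ W (φ p, 0) := hWs.contDiffAt (hOo.mem_nhds hz₀O)
  -- values of `W`
  have hWval : ∀ {q : M}, q ∈ (chartAt H p).source → ∀ ξ : E,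
      W (φ q, ξ) = φ (expMap cov q (e.symm q ξ)) := by
    intro q hq ξ
    show φ (ex (Φ.symm (φ q, ξ))) = _
    rw [hΦsymm hq]
  have hWval' : ∀ {q : M}, q ∈ (chartAt H p).source → ∀ w : TangentSpace I q,
      W (φ q, (e ⟨q, w⟩).2) = φ (expMap cov q w) := by
    intro q hq w
    rw [hWval hq, trivializationAt_symm_snd hq]
  have hW0 : W (φ p, 0) = φ p := by
    rw [hWval hps, trivializationAt_symm_self]
    show φ (ex ⟨p, 0⟩) = φ p
    rw [hex0]
  -- the derivative of `W` in the fibre direction at `(φ p, 0)` is the identity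
  obtain ⟨L, hL⟩ : ∃ L : E × E →L[ℝ] E, HasStrictFDerivAt W L (φ p, 0) :=
    ⟨_, hWat.hasStrictFDerivAt (by simp)⟩
  have hLinr : L.comp (ContinuousLinearMap.inr ℝ E E) = ContinuousLinearMap.id ℝ E := by
    obtain ⟨r, hr, -, -, hder⟩ := exists_ball_contDiffOn_extChartAt_expMap (cov := cov) hc p
    have h1 : HasFDerivAt (fun ξ : E ↦ W (φ p, ξ)) (L.comp (ContinuousLinearMap.inr ℝ E E)) 0 := by
      have h := hL.hasFDerivAt
      exact h.comp (0 : E) (hasFDerivAt_prodMk_right (φ p) (0 : E))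
    have h2 : (fun ξ : E ↦ W (φ p, ξ)) = fun v : E ↦ φ (expMap cov p (show TangentSpace I p from v)) := by
      funext ξ
      rw [hWval hps, trivializationAt_symm_self]
    rw [h2] at h1
    exact h1.unique hder
  -- the derivative of `F̂ (x, ξ) = (x, W (x, ξ))` at `(φ p, 0)` is an isomorphism of `E × E`
  set A : E →L[ℝ] E := L.comp (ContinuousLinearMap.inl ℝ E E) with hA
  have hLsplit : ∀ a b : E, L (a, b) = A a + b := fun a b ↦ by
    have h1 : ((a, b) : E × E) = ContinuousLinearMap.inl ℝ E E a + ContinuousLinearMap.inr ℝ E E b := by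
      simp
    have h2 : L (ContinuousLinearMap.inr ℝ E E b) = b := by
      have h := congrArg (fun T : E →L[ℝ] E ↦ T b) hLinr
      exact h
    rw [h1, map_add, h2]
    rfl
  set fwd : E × E →L[ℝ] E × E := (ContinuousLinearMap.fst ℝ E E).prod L with hfwd
  set inv : E × E →L[ℝ] E × E := (ContinuousLinearMap.fst ℝ E E).prod
    (ContinuousLinearMap.snd ℝ E E - A.comp (ContinuousLinearMap.fst ℝ E E)) with hinv
  have hfi : ∀ z, fwd (inv z) = z := fun z ↦ by
    obtain ⟨a, c⟩ := z
    simp only [hfwd, hinv, ContinuousLinearMap.prod_apply, ContinuousLinearMap.coe_fst',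
      FunLike.coe_sub, Pi.sub_apply, ContinuousLinearMap.coe_snd', ContinuousLinearMap.comp_apply]
    rw [hLsplit]
    abel_nf
  have hif : ∀ z, inv (fwd z) = z := fun z ↦ by
    obtain ⟨a, b⟩ := z
    simp only [hfwd, hinv, ContinuousLinearMap.prod_apply, ContinuousLinearMap.coe_fst',
      FunLike.coe_sub, Pi.sub_apply, ContinuousLinearMap.coe_snd', ContinuousLinearMap.comp_apply]
    rw [hLsplit]
    abel_nf
  set Leq : (E × E) ≃L[ℝ] (E × E) := ContinuousLinearEquiv.equivOfInverse fwd inv hif hfi with hLeq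
  set Fh : E × E → E × E := fun z ↦ (z.1, W z) with hFh
  have hFhd : HasStrictFDerivAt Fh (Leq : E × E →L[ℝ] E × E) (φ p, 0) :=
    hasStrictFDerivAt_fst.prodMk hL
  have hFhC : ContDiffAt ℝ ∞ Fh (φ p, 0) := contDiffAt_fst.prodMk hWat
  -- the inverse function theorem
  set Ĥ := hFhd.toOpenPartialHomeomorph Fh with hĤ
  have hĤcoe : ∀ z, Ĥ z = Fh z := fun z ↦ rfl
  have hsrc0 : (φ p, (0 : E)) ∈ Ĥ.source := hFhd.mem_toOpenPartialHomeomorph_source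
  have hFh0 : Fh (φ p, 0) = (φ p, φ p) := Prod.ext rfl hW0
  have htgt0 : (φ p, φ p) ∈ Ĥ.target := by
    rw [← hFh0]
    exact hFhd.image_mem_toOpenPartialHomeomorph_target
  have hĤsymm0 : Ĥ.symm (φ p, φ p) = (φ p, 0) := by
    rw [← hFh0]
    exact Ĥ.left_inv hsrc0
  have hĤfst : ∀ y ∈ Ĥ.target, (Ĥ.symm y).1 = y.1 := fun y hy ↦ by
    have h := Ĥ.right_inv hy
    have h2 : (Ĥ (Ĥ.symm y)).1 = (Ĥ.symm y).1 := rfl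
    rw [← h2, h]
  have hĤeq : ∀ y ∈ Ĥ.target, W (y.1, (Ĥ.symm y).2) = y.2 := fun y hy ↦ by
    have h := Ĥ.right_inv hy
    have h2 : (Ĥ (Ĥ.symm y)).2 = W (Ĥ.symm y) := rfl
    have h3 : Ĥ.symm y = (y.1, (Ĥ.symm y).2) := Prod.ext (hĤfst y hy) rfl
    rw [← h3, ← h2, h]
  -- `C¹` inverse near `(φ p, φ p)`
  have hsymmC : ContDiffAt ℝ ∞ Ĥ.symm (φ p, φ p) := by
    refine Ĥ.contDiffAt_symm (f₀' := Leq) htgt0 ?_ ?_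
    · rw [hĤsymm0]; exact hFhd.hasFDerivAt
    · rw [hĤsymm0]; exact hFhC
  obtain ⟨T₁, hT₁o, hT₁mem, hsymmT₁⟩ := hsymmC.contDiffWithinAt.contDiffOn' (m := 1)
    (by exact_mod_cast le_top) (by intro h; exact absurd h (by simp))
  rw [insert_eq_of_mem (mem_univ _), univ_inter] at hsymmT₁
  -- uniform coercivity near `p`, and the radius `r₁`
  obtain ⟨N, hN, hNsrc, m, hm, hmle⟩ := exists_nhds_mul_norm_sq_le_val g hg p
  obtain ⟨r₁, hr₁, hr₁src, hr₁N⟩ : ∃ r₁ > (0 : ℝ), ball (φ p) r₁ ×ˢ ball (0 : E) r₁ ⊆ Ĥ.source ∧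
      ∀ x ∈ ball (φ p) r₁, x ∈ φ.target ∧ φ.symm x ∈ N := by
    have h1 : Ĥ.source ∈ 𝓝 (φ p, (0 : E)) := Ĥ.open_source.mem_nhds hsrc0
    have h2 : φ.target ∩ φ.symm ⁻¹' N ∈ 𝓝 (φ p) := by
      refine inter_mem (extChartAt_target_mem_nhds (I := I) p) ?_
      refine (continuousAt_extChartAt_symm p).preimage_mem_nhds ?_
      rw [extChartAt_to_inv]
      exact hN
    obtain ⟨ra, hra, hra'⟩ := Metric.mem_nhds_iff.1 h2
    obtain ⟨rb, hrb, hrb'⟩ := Metric.mem_nhds_iff.1 h1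
    refine ⟨min ra rb, lt_min hra hrb, ?_, fun x hx ↦ hra' (ball_subset_ball (min_le_left _ _) hx)⟩
    intro z hz
    apply hrb'
    rw [← ball_prod_same]
    exact ⟨ball_subset_ball (min_le_right _ _) hz.1, ball_subset_ball (min_le_right _ _) hz.2⟩
  have hΦtgt : ∀ z : E × E, z.1 ∈ ball (φ p) r₁ → z ∈ Φ.target := fun z hz ↦ by
    rw [hΦ, show I.tangent = I.prod 𝓘(ℝ, E) from rfl, FiberBundle.extChartAt_target]
    refine ⟨⟨(hr₁N z.1 hz).1, ?_⟩, mem_univ _⟩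
    show φ.symm z.1 ∈ e.baseSet
    rw [TangentBundle.trivializationAt_baseSet]
    exact hNsrc (hr₁N z.1 hz).2
  -- target side: an open set `𝒯 ∋ (φ p, φ p)` on which the inverse is `C¹` and lands in the chart
  set G : E × E → M := fun y ↦ ex (Φ.symm (Ĥ.symm y)) with hG
  set 𝒯₀ : Set (E × E) := (T₁ ∩ Ĥ.target) ∩ Prod.fst ⁻¹' ball (φ p) r₁ with h𝒯₀
  have h𝒯₀o : IsOpen 𝒯₀ := (hT₁o.inter Ĥ.open_target).inter (isOpen_ball.preimage continuous_fst)
  have hGc : ContinuousOn G 𝒯₀ := by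
    refine hexs.continuous.comp_continuousOn ?_
    refine (continuousOn_extChartAt_symm z₀).comp (Ĥ.continuousOn_symm.mono fun y hy ↦ hy.1.2) ?_
    intro y hy
    apply hΦtgt
    rw [hĤfst y hy.1.2]
    exact hy.2
  set 𝒯 : Set (E × E) := 𝒯₀ ∩ G ⁻¹' (chartAt H p).source with h𝒯
  have h𝒯o : IsOpen 𝒯 := hGc.isOpen_inter_preimage h𝒯₀o (chartAt H p).open_source
  have hG0 : G (φ p, φ p) = p := by
    show ex (Φ.symm (Ĥ.symm (φ p, φ p))) = p
    rw [hĤsymm0, hΦsymm hps, trivializationAt_symm_self]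
    exact hex0 p
  have h𝒯mem : (φ p, φ p) ∈ 𝒯 := by
    refine ⟨⟨⟨hT₁mem, htgt0⟩, ?_⟩, ?_⟩
    · show (φ p, φ p).1 ∈ ball (φ p) r₁
      exact mem_ball_self hr₁
    · show G (φ p, φ p) ∈ (chartAt H p).source
      rw [hG0]
      exact hps
  obtain ⟨r₂, hr₂, hr₂𝒯⟩ : ∃ r₂ > (0 : ℝ), ball (φ p) r₂ ×ˢ ball (φ p) r₂ ⊆ 𝒯 := by
    obtain ⟨rb, hrb, hrb'⟩ := Metric.mem_nhds_iff.1 (h𝒯o.mem_nhds h𝒯mem)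
    refine ⟨rb, hrb, ?_⟩
    rw [ball_prod_same]
    exact hrb'
  -- the radius
  set r : ℝ := min r₁ r₂ with hr_def
  have hr : 0 < r := lt_min hr₁ hr₂
  set U₀ : Set M := φ.source ∩ φ ⁻¹' ball (φ p) r with hU₀
  have hU₀o : IsOpen U₀ :=
    (continuousOn_extChartAt p).isOpen_inter_preimage (isOpen_extChartAt_source p) isOpen_ball
  have hpU₀ : p ∈ U₀ := ⟨mem_extChartAt_source p, mem_ball_self hr⟩
  set ε₀ : ℝ := r * Real.sqrt m / 2 with hε₀_def
  have hε₀ : 0 < ε₀ := by positivity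
  obtain ⟨δ, hδ, hδU₀⟩ : ∃ δ > (0 : ℝ), {y : M | g.edist hg p y < ENNReal.ofReal δ} ⊆ U₀ := by
    obtain ⟨ρ₀, hρ₀, hρ₀U⟩ := exists_setOf_edist_lt_subset hg (hU₀o.mem_nhds hpU₀)
    obtain ⟨δ, -, hδ0, hδρ⟩ := ENNReal.lt_iff_exists_real_btwn.1 hρ₀
    refine ⟨δ, ?_, fun y hy ↦ hρ₀U (lt_trans hy hδρ)⟩
    simpa using hδ0
  set ε : ℝ := min ε₀ (δ / 3) with hε_def
  have hε : 0 < ε := lt_min hε₀ (by positivity)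
  have hεε₀ : ε ≤ ε₀ := min_le_left _ _
  have h3ε : 3 * ε ≤ δ := by
    have : ε ≤ δ / 3 := min_le_right _ _
    linarith
  -- the neighbourhood `U = {d(p, ·) < ε}`
  refine ⟨{q : M | g.edist hg p q < ENNReal.ofReal ε}, setOf_edist_lt_mem_nhds hg p (by simpa using hε),
    ε, hε, fun q hq ↦ ?_⟩
  have hq : g.edist hg p q < ENNReal.ofReal ε := hq
  -- distance bookkeeping: `d(q, exp_q v) ≤ |v|`, points within `2ε` of `q` lie in `U₀`
  have hdexp : ∀ v : TangentSpace I q,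
      g.edist hg q (expMap cov q v) ≤ ENNReal.ofReal (Real.sqrt (g.val q v v)) := fun v ↦ by
    obtain ⟨-, -, h0, -⟩ := maximalGeodesic_of_isGeodesicallyComplete hc q v
    have h := edist_maximalGeodesic_le_length (g := g) hg hc q v zero_le_one
    rw [length_maximalGeodesic hg hc q v 0 1, sub_zero, one_mul, h0,
      ← expMap_eq_maximalGeodesic hc q v] at h
    exact h
  have hU₀_of_lt : ∀ y : M, g.edist hg q y < ENNReal.ofReal (2 * ε) → y ∈ U₀ := fun y hy ↦ by
    apply hδU₀
    show g.edist hg p y < ENNReal.ofReal δ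
    calc g.edist hg p y ≤ g.edist hg p q + g.edist hg q y := edist_triangle hg p q y
      _ < ENNReal.ofReal ε + ENNReal.ofReal (2 * ε) := ENNReal.add_lt_add hq hy
      _ = ENNReal.ofReal (3 * ε) := by rw [← ENNReal.ofReal_add hε.le (by positivity)]; ring_nf
      _ ≤ ENNReal.ofReal δ := ENNReal.ofReal_le_ofReal h3ε
  have hqU₀ : q ∈ U₀ := hU₀_of_lt q (by
    rw [PseudoRiemannianMetric.edist_self hg]; exact ENNReal.ofReal_pos.2 (by positivity))
  have hqs : q ∈ (chartAt H p).source := by rw [← hφsrc]; exact hqU₀.1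
  have hφq : φ q ∈ ball (φ p) r := hqU₀.2
  have hφq₁ : φ q ∈ ball (φ p) r₁ := ball_subset_ball (min_le_left _ _) hφq
  have hφq₂ : φ q ∈ ball (φ p) r₂ := ball_subset_ball (min_le_right _ _) hφq
  have hqN : q ∈ N := by
    have h := (hr₁N (φ q) hφq₁).2
    rwa [φ.left_inv hqU₀.1] at h
  -- chart-smallness of `g`-short vectors at `q`
  have hsmall : ∀ v : TangentSpace I q, g.val q v v < ε ^ 2 → (e ⟨q, v⟩).2 ∈ ball (0 : E) r₁ := by
    intro v hv
    rw [mem_ball_zero_iff]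
    have h1 : m * ‖(e ⟨q, v⟩).2‖ ^ 2 ≤ g.val q v v := hmle q hqN v
    have h2 : ε ^ 2 ≤ ε₀ ^ 2 := pow_le_pow_left₀ hε.le hεε₀ 2
    have h3 : ε₀ ^ 2 = r ^ 2 * m / 4 := by
      rw [hε₀_def, div_pow, mul_pow, Real.sq_sqrt hm.le]; ring
    have h4 : m * ‖(e ⟨q, v⟩).2‖ ^ 2 < r ^ 2 * m / 4 := by linarith
    have h5 : ‖(e ⟨q, v⟩).2‖ ^ 2 < (r / 2) ^ 2 := by
      have : ‖(e ⟨q, v⟩).2‖ ^ 2 < r ^ 2 / 4 := by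
        by_contra hcon
        push Not at hcon
        have := mul_le_mul_of_nonneg_left hcon hm.le
        linarith
      calc ‖(e ⟨q, v⟩).2‖ ^ 2 < r ^ 2 / 4 := this
        _ = (r / 2) ^ 2 := by ring
    have h6 : ‖(e ⟨q, v⟩).2‖ < r / 2 := by
      exact lt_of_pow_lt_pow_left₀ 2 (by positivity) h5
    have h7 : r / 2 < r₁ := by
      have : r ≤ r₁ := min_le_left _ _
      linarith
    linarith
  -- the local inverse `Lq` of `exp_q`, the map `Fq = exp_q` and the set `Uq`
  set Fq : E → M := fun v ↦ expMap cov q (show TangentSpace I q from v) with hFq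
  set Lq : M → E := fun y ↦ e.symm q (Ĥ.symm (φ q, φ y)).2 with hLq
  have hpair : ∀ y ∈ U₀, (φ q, φ y) ∈ 𝒯 := fun y hy ↦
    hr₂𝒯 ⟨hφq₂, ball_subset_ball (min_le_right _ _) hy.2⟩
  -- right inverse on `U₀`
  have hright : ∀ y ∈ U₀, Fq (Lq y) = y := by
    intro y hy
    have hyT := hpair y hy
    have hyt : (φ q, φ y) ∈ Ĥ.target := hyT.1.1.2
    have hW1 : W (φ q, (Ĥ.symm (φ q, φ y)).2) = φ y := hĤeq (φ q, φ y) hyt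
    rw [hWval hqs] at hW1
    -- both points lie in the chart source
    have hG1 : G (φ q, φ y) = expMap cov q (e.symm q (Ĥ.symm (φ q, φ y)).2) := by
      show ex (Φ.symm (Ĥ.symm (φ q, φ y))) = _
      have h3 : Ĥ.symm (φ q, φ y) = (φ q, (Ĥ.symm (φ q, φ y)).2) := Prod.ext (hĤfst _ hyt) rfl
      rw [h3, hΦsymm hqs]
    have hmem1 : expMap cov q (e.symm q (Ĥ.symm (φ q, φ y)).2) ∈ φ.source := by
      rw [hφsrc, ← hG1]
      exact hyT.2
    exact (extChartAt I p).injOn hmem1 hy.1 hW1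
  -- left inverse on the `g_q`-ball of radius `ε`
  have hleft : ∀ v : E, g.val q (show TangentSpace I q from v) (show TangentSpace I q from v) < ε ^ 2 →
      Fq v ∈ U₀ ∧ Lq (Fq v) = v := by
    intro v hv
    have hFvU₀ : Fq v ∈ U₀ := by
      apply hU₀_of_lt
      calc g.edist hg q (Fq v) ≤ ENNReal.ofReal (Real.sqrt (g.val q (show TangentSpace I q from v)
            (show TangentSpace I q from v))) := hdexp _
        _ < ENNReal.ofReal (2 * ε) := by
          apply (ENNReal.ofReal_lt_ofReal_iff (by positivity)).2
          have h1 : Real.sqrt (g.val q (show TangentSpace I q from v) (show TangentSpace I q from v)) < ε := by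
            rw [Real.sqrt_lt' hε]
            exact hv
          linarith
    refine ⟨hFvU₀, ?_⟩
    set ξ : E := (e ⟨q, (show TangentSpace I q from v)⟩).2 with hξ
    have hξr : ξ ∈ ball (0 : E) r₁ := hsmall _ hv
    have hsrc : (φ q, ξ) ∈ Ĥ.source := hr₁src ⟨hφq₁, hξr⟩
    have hĤapp : Ĥ (φ q, ξ) = (φ q, φ (Fq v)) := by
      rw [hĤcoe]
      show ((φ q, ξ).1, W (φ q, ξ)) = (φ q, φ (Fq v))
      rw [hWval' hqs]
    show e.symm q (Ĥ.symm (φ q, φ (Fq v))).2 = v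
    rw [← hĤapp, Ĥ.left_inv hsrc]
    exact trivializationAt_symm_snd hqs _
  -- regularity of `Lq` on `U₀`
  have hLqs : ContMDiffOn I 𝓘(ℝ, E) 1 Lq U₀ := by
    have h0 : ContMDiffOn I 𝓘(ℝ, E) 1 φ U₀ := (contMDiffOn_extChartAt (n := 1) (x := p)).mono
        (fun y (hy : y ∈ U₀) ↦ by rw [← extChartAt_source I p]; exact hy.1)
    have h1 : ContMDiffOn I 𝓘(ℝ, E × E) 1 (fun y : M ↦ (φ q, φ y)) U₀ :=
      (contMDiff_iff_contDiff.2 (contDiff_prodMk_right (φ q) (n := 1))).comp_contMDiffOn h0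
    have h2 : ContMDiffOn 𝓘(ℝ, E × E) 𝓘(ℝ, E × E) 1 Ĥ.symm T₁ :=
      contMDiffOn_iff_contDiffOn.2 hsymmT₁
    have h3 : ContMDiffOn I 𝓘(ℝ, E × E) 1 (fun y : M ↦ Ĥ.symm (φ q, φ y)) U₀ :=
      h2.comp h1 fun y hy ↦ (hpair y hy).1.1.1
    have h4 : ContMDiffOn I 𝓘(ℝ, E) 1 (fun y : M ↦ (Ĥ.symm (φ q, φ y)).2) U₀ :=
      (contMDiff_iff_contDiff.2 (contDiff_snd (𝕜 := ℝ) (E := E) (F := E) (n := 1))).comp_contMDiffOn h3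
    set T : E →L[ℝ] E := (show E →L[ℝ] E from e.symmL ℝ q) with hT
    have h5 : ContMDiff 𝓘(ℝ, E) 𝓘(ℝ, E) 1 (fun ξ : E ↦ T ξ) :=
      contMDiff_iff_contDiff.2 T.contDiff
    have h6 := h5.comp_contMDiffOn h4
    refine h6.congr fun y _ ↦ ?_
    show e.symm q (Ĥ.symm (φ q, φ y)).2 = e.symmL ℝ q (Ĥ.symm (φ q, φ y)).2
    rw [e.symmL_apply (R := ℝ)]
    rw [TangentBundle.trivializationAt_baseSet]
    exact hqs
  -- the data of `GeodesicBallsMetric` at `q`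
  set Gq : E →L[ℝ] E →L[ℝ] ℝ := g.val q with hGq
  have hGqc : Continuous fun v : E ↦ Gq v v := Gq.continuous₂.comp (continuous_id.prodMk continuous_id)
  set Uq : Set M := U₀ ∩ Lq ⁻¹' {v : E | Gq v v < ε ^ 2} with hUq
  have hUqo : IsOpen Uq :=
    hLqs.continuousOn.isOpen_inter_preimage hU₀o (isOpen_lt hGqc continuous_const)
  have hF0 : Fq 0 = q := expMap_zero (cov := cov) q
  have hLF : ∀ v : E, g.val q (show TangentSpace I q from v) (show TangentSpace I q from v) < ε ^ 2 →
      Fq v ∈ Uq ∧ Lq (Fq v) = v := fun v hv ↦ by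
    obtain ⟨h1, h2⟩ := hleft v hv
    refine ⟨⟨h1, ?_⟩, h2⟩
    show Gq (Lq (Fq v)) (Lq (Fq v)) < ε ^ 2
    rw [h2]
    exact hv
  have hFL : ∀ y ∈ Uq, g.val q (show TangentSpace I q from Lq y) (show TangentSpace I q from Lq y) <
      ε ^ 2 ∧ Fq (Lq y) = y := fun y hy ↦ ⟨hy.2, hright y hy.1⟩
  have hL : ContMDiffOn I 𝓘(ℝ, E) 1 Lq Uq := hLqs.mono inter_subset_left
  have hFs : ContMDiffOn 𝓘(ℝ, E) I 1 Fq
      {v : E | g.val q (show TangentSpace I q from v) (show TangentSpace I q from v) < ε ^ 2} :=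
    (contMDiff_expMap_of_isGeodesicallyComplete (cov := cov) (k := 1) le_rfl hc q).contMDiffOn
  have hdom : ∀ v : TangentSpace I q, v ∈ expDomain cov q := fun v ↦ by
    rw [expDomain_eq_univ (cov := cov) hc q]; exact mem_univ _
  have hrad : ∀ v : E, g.val q (show TangentSpace I q from v) (show TangentSpace I q from v) < ε ^ 2 →
      g.val (Fq v) (mfderiv 𝓘(ℝ, E) I Fq v v) (mfderiv 𝓘(ℝ, E) I Fq v v) =
        g.val q (show TangentSpace I q from v) (show TangentSpace I q from v) := fun v _ ↦
    gaussLemma g hn q (hdom (show TangentSpace I q from v)) (show TangentSpace I q from v)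
  have hgauss : ∀ v β : E,
      g.val q (show TangentSpace I q from v) (show TangentSpace I q from v) < ε ^ 2 →
      g.val q (show TangentSpace I q from v) (show TangentSpace I q from β) = 0 →
      g.val (Fq v) (mfderiv 𝓘(ℝ, E) I Fq v v) (mfderiv 𝓘(ℝ, E) I Fq v β) = 0 := by
    intro v β _ hvβ
    have h := gaussLemma g hn q (hdom (show TangentSpace I q from v)) (show TangentSpace I q from β)
    rw [g.symm (Fq v), g.symm q] at h
    -- h : g (dF v) (dF β) = g_q v β  (after symmetrisation)
    rw [h]
    exact hvβ
  -- conclusions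
  refine ⟨fun v hv ↦ ?_, fun x hx ↦ ?_, ?_⟩
  · exact edist_eq_of_mem_ball hg hε hF0 hUqo hLF hFL hL hFs hrad hgauss hv
  · obtain ⟨v, hv, hFv, -⟩ := exists_eq_of_edist_lt hg hε hF0 hUqo hLF hFL hL hFs hrad hgauss hx
    exact ⟨v, hv, hFv⟩
  · intro v₁ hv₁ v₂ hv₂ h12
    have h1 := (hleft v₁ hv₁).2
    have h2 := (hleft v₂ hv₂).2
    have h3 : Fq v₁ = Fq v₂ := h12
    rw [← h1, ← h2, h3]

/-- **A compact Riemannian manifold has a uniform normal radius** (Lee 2018, Lemma 6.16 with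
Prop. 6.11 / Cor. 6.12–6.13; equivalently, positivity of the injectivity radius of a compact
manifold together with "radial geodesics shorter than the injectivity radius minimise"): for a
smooth Riemannian metric on a compact Hausdorff manifold (boundaryless model) there is ONE `ε > 0`
such that for every point `q`: (1) `d(q, exp_q v) = |v|_g` for `|v|_g < ε`; (2) every `x` with
`d(q, x) < ε` is `exp_q v` with `|v|_g < ε`; (3) `exp_q` is injective on `{|v|_g < ε}`. Proof:
finitely many of the uniformly normal neighbourhoods of `exists_uniformly_normal_nhds` cover `M`;
take the least of their radii. [cite: LeeRiemannianManifolds2018, Lemma 6.16, Prop. 6.11 and Cor. 6.12–6.13] -/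
theorem exists_uniform_normalRadius [CompactSpace M] (hn : (∞ : ℕ∞ω) ≤ n) (hg : g.IsRiemannian) :
    ∃ ε > (0 : ℝ), ∀ q : M,
      (∀ v : TangentSpace I q, g.val q v v < ε ^ 2 →
        g.edist hg q (expMap g.leviCivita q v) = ENNReal.ofReal (Real.sqrt (g.val q v v))) ∧
      (∀ x : M, g.edist hg q x < ENNReal.ofReal ε →
        ∃ v : TangentSpace I q, g.val q v v < ε ^ 2 ∧ expMap g.leviCivita q v = x) ∧
      InjOn (fun v : TangentSpace I q ↦ expMap g.leviCivita q v) {v | g.val q v v < ε ^ 2} := by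
  classical
  have hc : IsGeodesicallyComplete g.leviCivita := hopfRinow_compact_geodesicallyComplete hn hg
  choose U hU ε hε hP using fun p : M ↦ exists_uniformly_normal_nhds g hn hg hc p
  obtain ⟨t, -, ht⟩ := isCompact_univ.elim_nhds_subcover U fun p _ ↦ hU p
  rcases t.eq_empty_or_nonempty with h0 | hne
  · refine ⟨1, one_pos, fun q ↦ ?_⟩
    have h := ht (mem_univ q)
    simp [h0] at h
  obtain ⟨p₀, hp₀, hmin⟩ := t.exists_min_image ε hne
  refine ⟨ε p₀, hε p₀, fun q ↦ ?_⟩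
  obtain ⟨p, hp, hqp⟩ := mem_iUnion₂.1 (ht (mem_univ q))
  obtain ⟨h1, h2, h3⟩ := hP p q hqp
  have hle : ε p₀ ≤ ε p := hmin p hp
  have hle2 : ε p₀ ^ 2 ≤ ε p ^ 2 := pow_le_pow_left₀ (hε p₀).le hle 2
  refine ⟨fun v hv ↦ h1 v (lt_of_lt_of_le hv hle2), fun x hx ↦ ?_,
    h3.mono fun v hv ↦ lt_of_lt_of_le hv hle2⟩
  obtain ⟨v, hv, hvx⟩ := h2 x (lt_of_lt_of_le hx (ENNReal.ofReal_le_ofReal hle))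
  refine ⟨v, ?_, hvx⟩
  have hd : g.edist hg q x = ENNReal.ofReal (Real.sqrt (g.val q v v)) := by rw [← hvx]; exact h1 v hv
  rw [hd, ENNReal.ofReal_lt_ofReal_iff (hε p₀)] at hx
  rw [Real.sqrt_lt' (hε p₀)] at hx
  exact hx

end Uniform

end Literature.Geometry.Riemannian
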